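import Mathlib
import HarnessLib
import Summits.ResolutionOfSingularities.ResolutionOfSingularities.Theorems.WildQuotientsWildQuotientResolutionS1aQhSymChartRows

/-!
# S1a — R4c cusp, brick (b3-iterates): `σ_R`-ITERATES READ IN THE PINNED CHART MODEL — `Φ(σ_Rʲ z /1) = τ′ʲ(Φ(z/1))`, closed forms, and the images of the
intrinsic norms `N_R(u₂′)`, `N_R(ĥ)` (two moving generators)

[OURS · L1 W4.5c · lead-1 g17; plan-1 RULING R-F15v (2) ★ R4c `cusp_killsIn_two`, memo `Cruxes/CyclicQuotientFourfolds/Lines/s1a_logminvertex-R4c-PROGRESS.md` §2/§4: the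
member chart `U_O` inverts `b̂ = Z^D c^{−6p}` with `Z = N_R(u₂′)·N_R(ĥ)` (✓CuspMemberZ, ✓ChartBHat); the localised model needs the POLYNOMIAL `b′` with `Φ(Z/1) = b′/1`:
this file computes `Φ(N_R(u₂′)/1) = ∏ₗ(x′₂ + l·x_none^sh x′₀)` and `Φ(N_R(ĥ)/1) = ∏ₗ hₗ` from the rows ✓`QhSym.qsc_*` (`map_algebraMap_iterate_sigmaR`, `qsc_iterate_X1/X2`,
`qsc_map_normR_u2`, `qsc_map_normR_hHat`)] — NOT statements of the manuscript; counted 0; AI-level work, weaker than expert review. Crux stmt-ResolutionOfSingularities-17941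
`CyclicQuotientFourfolds`, line `s1a-logminvertex` v13 (`stub_reachLowerInFX`).
-/

set_option linter.dupNamespace false

noncomputable section

open MvPolynomial
open Literature.AlgebraicGeometry.Resolution
open scoped LaurentPolynomial
open Summit.ResolutionOfSingularities.ResolutionOfSingularities.Theorems.WildQuotientResolution.S1
open Summit.ResolutionOfSingularities.ResolutionOfSingularities.Theorems.WildQuotientResolution.S1.CoarseChart
open Summit.ResolutionOfSingularities.ResolutionOfSingularities.Theorems.WildQuotientResolution.S1.ProducerStep
open Summit.ResolutionOfSingularities.ResolutionOfSingularities.Theorems.WildQuotientResolution.S1.ReesBigrading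
open Summit.ResolutionOfSingularities.ResolutionOfSingularities.Theorems.WildQuotientResolution.S1.NodeTransport
open Summit.ResolutionOfSingularities.ResolutionOfSingularities.Theorems.WildQuotientResolution.S1.CobordantTransport
open Summit.ResolutionOfSingularities.ResolutionOfSingularities.Theorems.WildQuotientResolution.S1.NodeAway
open Summit.ResolutionOfSingularities.ResolutionOfSingularities.Theorems.WildQuotientResolution.S1.CentreAway
open Summit.ResolutionOfSingularities.ResolutionOfSingularities.Theorems.WildQuotientResolution.S1.BlowupCharts
open Summit.ResolutionOfSingularities.ResolutionOfSingularities.Theorems.WildQuotientResolution.S1.KillCert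
open Summit.ResolutionOfSingularities.ResolutionOfSingularities.Theorems.WildQuotientResolution.S1.GameFrame.GModel

namespace Summit.ResolutionOfSingularities.ResolutionOfSingularities.Theorems.WildQuotientResolution.S1.KillCert.QhSym

variable {k : Type} [Field k] (σ : (MvPolynomial (Fin 4) k) ≃+* (MvPolynomial (Fin 4) k)) (hC : ∀ a : k, σ (C a) = C a)
  (h0 : σ (X 0) = X 0) (h1 : σ (X 1) = X 1 + X 0) (h2 : σ (X 2) = X 2 + X 0) (t₀ : (MvPolynomial (Fin 4) k)) (h3 : σ (X 3) = X 3 + t₀)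
  (w : Fin 3 → ℕ) (sh : ℕ) (hw1 : w 1 + sh ≤ w 0) (hw2 : w 0 = w 2 + sh) (hh : (MvPolynomial (Fin 4) k)) (hσh : σ hh = hh)
  {p : ℕ} (hp : 0 < p) (hσpL : ∀ y : (Localization.Away hh), (⇑(sigmaAway σ hσh))^[p] y = y)
  (hσJ : ∀ n : ℕ, ((weightedFiltration (fun i => algebraMap (MvPolynomial (Fin 4) k) (Localization.Away hh) (X ((![0, 1, 2] : Fin 3 → Fin 4) i))) w).ideal n).map ((sigmaAway σ hσh) : (Localization.Away hh) →+* (Localization.Away hh)) ≤ (weightedFiltration (fun i => algebraMap (MvPolynomial (Fin 4) k) (Localization.Away hh) (X ((![0, 1, 2] : Fin 3 → Fin 4) i))) w).ideal n)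
  {mg : ℕ} (mo : Fin mg → ℕ) (𝒜 : (Π j : Fin mg, ZMod (mo j)) → AddSubgroup (Localization.Away hh)) [GradedRing 𝒜]
  {dbar : ℕ} (y : ↥(𝒜 0)) (hy : y ∈ (traceFiltration 𝒜 (fun i => algebraMap (MvPolynomial (Fin 4) k) (Localization.Away hh) (X ((![0, 1, 2] : Fin 3 → Fin 4) i))) w).ideal dbar) (hσy : (sigmaAway σ hσh) (y : (Localization.Away hh)) = y)
  {P : Type} [CommRing P] [Algebra (MvPolynomial (Option (Fin 4)) k) P] (Φ : (ChartRing 𝒜 (fun i => algebraMap (MvPolynomial (Fin 4) k) (Localization.Away hh) (X ((![0, 1, 2] : Fin 3 → Fin 4) i))) w dbar y hy) ≃+* P)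
  (hΦa : ∀ a : (MvPolynomial (Fin 4) k), Φ ((algebraMap ↥(cobordantAlgebra (fun i => algebraMap (MvPolynomial (Fin 4) k) (Localization.Away hh) (X ((![0, 1, 2] : Fin 3 → Fin 4) i))) w) (ChartRing 𝒜 (fun i => algebraMap (MvPolynomial (Fin 4) k) (Localization.Away hh) (X ((![0, 1, 2] : Fin 3 → Fin 4) i))) w dbar y hy)) (algebraMap (Localization.Away hh) ↥(cobordantAlgebra (fun i => algebraMap (MvPolynomial (Fin 4) k) (Localization.Away hh) (X ((![0, 1, 2] : Fin 3 → Fin 4) i))) w) (algebraMap (MvPolynomial (Fin 4) k) (Localization.Away hh) a))) = (algebraMap (MvPolynomial (Option (Fin 4)) k) P) (cobordantAlgebra.subst k (![w 0, w 1, w 2, 0] : Fin 4 → ℕ) a))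
  (hΦs : Φ ((algebraMap ↥(cobordantAlgebra (fun i => algebraMap (MvPolynomial (Fin 4) k) (Localization.Away hh) (X ((![0, 1, 2] : Fin 3 → Fin 4) i))) w) (ChartRing 𝒜 (fun i => algebraMap (MvPolynomial (Fin 4) k) (Localization.Away hh) (X ((![0, 1, 2] : Fin 3 → Fin 4) i))) w dbar y hy)) (cobordantAlgebra.s (fun i => algebraMap (MvPolynomial (Fin 4) k) (Localization.Away hh) (X ((![0, 1, 2] : Fin 3 → Fin 4) i))) w)) = (algebraMap (MvPolynomial (Option (Fin 4)) k) P) (X none))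
  (hΦu : ∀ i : Fin 3, Φ ((algebraMap ↥(cobordantAlgebra (fun i => algebraMap (MvPolynomial (Fin 4) k) (Localization.Away hh) (X ((![0, 1, 2] : Fin 3 → Fin 4) i))) w) (ChartRing 𝒜 (fun i => algebraMap (MvPolynomial (Fin 4) k) (Localization.Away hh) (X ((![0, 1, 2] : Fin 3 → Fin 4) i))) w dbar y hy)) (cobordantAlgebra.u' (fun i => algebraMap (MvPolynomial (Fin 4) k) (Localization.Away hh) (X ((![0, 1, 2] : Fin 3 → Fin 4) i))) w i)) = (algebraMap (MvPolynomial (Option (Fin 4)) k) P) (X (some ((![0, 1, 2] : Fin 3 → Fin 4) i))))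


omit [Algebra (MvPolynomial (Option (Fin 4)) k) P] in
/-- Iterates of a ring automorphism are ring homomorphisms. [folklore] -/
theorem exists_ringHom_eq_iterate (e : P ≃+* P) (n : ℕ) : ∃ g : P →+* P, (⇑g : P → P) = (⇑e)^[n] := by
  induction n with
  | zero => exact ⟨RingHom.id P, by funext x; simp⟩
  | succ n ih =>
    obtain ⟨g, hg⟩ := ih
    exact ⟨e.toRingHom.comp g, by funext x; rw [Function.iterate_succ_apply', ← hg]; rfl⟩

set_option maxHeartbeats 400000 in
omit [Algebra (MvPolynomial (Option (Fin 4)) k) P] in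
/-- **`Φ` intertwines `σ_R`-iterates on `R^w` with `τ′`-iterates on the model**: `Φ(σ_Rʲ z / 1) = τ′ʲ (Φ(z/1))`. [OURS · L1 W4.5c · R4c] -/
theorem map_algebraMap_iterate_sigmaR (z : ↥(cobordantAlgebra (fun i => algebraMap (MvPolynomial (Fin 4) k) (Localization.Away hh) (X ((![0, 1, 2] : Fin 3 → Fin 4) i))) w)) (j : ℕ) : Φ ((algebraMap ↥(cobordantAlgebra (fun i => algebraMap (MvPolynomial (Fin 4) k) (Localization.Away hh) (X ((![0, 1, 2] : Fin 3 → Fin 4) i))) w) (ChartRing 𝒜 (fun i => algebraMap (MvPolynomial (Fin 4) k) (Localization.Away hh) (X ((![0, 1, 2] : Fin 3 → Fin 4) i))) w dbar y hy)) ((⇑(sigmaR (sigmaAway σ hσh) (fun i => algebraMap (MvPolynomial (Fin 4) k) (Localization.Away hh) (X ((![0, 1, 2] : Fin 3 → Fin 4) i))) w hσJ hp hσpL))^[j] z)) = (⇑(conj Φ (sigmaChart 𝒜 (fun i => algebraMap (MvPolynomial (Fin 4) k) (Localization.Away hh) (X ((![0, 1, 2] : Fin 3 → Fin 4) i))) w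 dbar y hy (sigmaAway σ hσh) hσJ hp hσpL hσy)))^[j] (Φ ((algebraMap ↥(cobordantAlgebra (fun i => algebraMap (MvPolynomial (Fin 4) k) (Localization.Away hh) (X ((![0, 1, 2] : Fin 3 → Fin 4) i))) w) (ChartRing 𝒜 (fun i => algebraMap (MvPolynomial (Fin 4) k) (Localization.Away hh) (X ((![0, 1, 2] : Fin 3 → Fin 4) i))) w dbar y hy)) z)) := by
  induction j with
  | zero => rfl
  | succ j ih => rw [Function.iterate_succ_apply', Function.iterate_succ_apply', ← ih, ← sigmaChart_algebraMap, conj_apply_map]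

set_option maxHeartbeats 1600000 in
include h0 h1 h2 h3 hC hw2 hΦa hΦs hΦu in
/-- Closed form: `τ′ʲ x′₂ = x′₂ + j·x_none^sh x′₀`. [OURS · L1 W4.5c · R4c] -/
theorem qsc_iterate_X2 (j : ℕ) :
    (⇑(conj Φ (sigmaChart 𝒜 (fun i => algebraMap (MvPolynomial (Fin 4) k) (Localization.Away hh) (X ((![0, 1, 2] : Fin 3 → Fin 4) i))) w dbar y hy (sigmaAway σ hσh) hσJ hp hσpL hσy)))^[j] ((algebraMap (MvPolynomial (Option (Fin 4)) k) P) (X (some 2))) = (algebraMap (MvPolynomial (Option (Fin 4)) k) P) (X (some 2)) + (j : P) * ((algebraMap (MvPolynomial (Option (Fin 4)) k) P) (X none) ^ sh * (algebraMap (MvPolynomial (Option (Fin 4)) k) P) (X (some 0))) := by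
  obtain ⟨rn, r0, -⟩ := qsc_rows_fixed σ hC h0 h1 h2 t₀ h3 w hh hσh hp hσpL hσJ mo 𝒜 y hy hσy Φ hΦa hΦs hΦu
  have r2 := qsc_row_two σ h0 h1 h2 t₀ h3 w sh hw2 hh hσh hp hσpL hσJ mo 𝒜 y hy hσy Φ hΦs hΦu
  induction j with
  | zero => simp
  | succ j ih =>
    rw [Function.iterate_succ_apply', ih, map_add, map_mul, map_natCast, map_mul, map_pow, r2, rn, r0]
    push_cast
    ring

set_option maxHeartbeats 1600000 in
include h0 h1 h2 h3 hC hw1 hΦa hΦs hΦu in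
/-- Closed form: `τ′ʲ x′₁ = x′₁ + j·x_none^sh (x′₀ x_none^{w₀−w₁−sh})`. [OURS · L1 W4.5c · R4c] -/
theorem qsc_iterate_X1 (j : ℕ) :
    (⇑(conj Φ (sigmaChart 𝒜 (fun i => algebraMap (MvPolynomial (Fin 4) k) (Localization.Away hh) (X ((![0, 1, 2] : Fin 3 → Fin 4) i))) w dbar y hy (sigmaAway σ hσh) hσJ hp hσpL hσy)))^[j] ((algebraMap (MvPolynomial (Option (Fin 4)) k) P) (X (some 1))) = (algebraMap (MvPolynomial (Option (Fin 4)) k) P) (X (some 1)) + (j : P) * ((algebraMap (MvPolynomial (Option (Fin 4)) k) P) (X none) ^ sh * ((algebraMap (MvPolynomial (Option (Fin 4)) k) P) (X (some 0)) * (algebraMap (MvPolynomial (Option (Fin 4)) k) P) (X none) ^ (w 0 - (w 1 + sh)))) := by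
  obtain ⟨rn, r0, -⟩ := qsc_rows_fixed σ hC h0 h1 h2 t₀ h3 w hh hσh hp hσpL hσJ mo 𝒜 y hy hσy Φ hΦa hΦs hΦu
  have r1 := qsc_row_one σ h0 h1 h2 t₀ h3 w sh hw1 hh hσh hp hσpL hσJ mo 𝒜 y hy hσy Φ hΦs hΦu
  induction j with
  | zero => simp
  | succ j ih =>
    rw [Function.iterate_succ_apply', ih, map_add, map_mul, map_natCast, map_mul, map_pow, map_mul, map_pow, r1, rn, r0]
    push_cast
    ring

set_option maxHeartbeats 1600000 in
set_option synthInstance.maxHeartbeats 400000 in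
include h0 h1 h2 h3 hC hw2 hΦa hΦs hΦu hσy in
/-- **Image of the intrinsic norm of `u₂′`**: `Φ(N_R(u₂′)/1) = ∏ₗ (x′₂ + l·x_none^sh x′₀)`. [OURS · L1 W4.5c · R4c] -/
theorem qsc_map_normR_u2 [NeZero p] :
    Φ ((algebraMap ↥(cobordantAlgebra (fun i => algebraMap (MvPolynomial (Fin 4) k) (Localization.Away hh) (X ((![0, 1, 2] : Fin 3 → Fin 4) i))) w) (ChartRing 𝒜 (fun i => algebraMap (MvPolynomial (Fin 4) k) (Localization.Away hh) (X ((![0, 1, 2] : Fin 3 → Fin 4) i))) w dbar y hy)) (∏ j : ZMod p, (⇑(sigmaR (sigmaAway σ hσh) (fun i => algebraMap (MvPolynomial (Fin 4) k) (Localization.Away hh) (X ((![0, 1, 2] : Fin 3 → Fin 4) i))) w hσJ hp hσpL))^[j.val] (cobordantAlgebra.u' (fun i => algebraMap (MvPolynomial (Fin 4) k) (Localization.Away hh) (X ((![0, 1, 2] : Fin 3 → Fin 4) i))) w 2))) = (algebraMap (MvPolynomial (Option (Fin 4)) k) P) (∏ j : ZMod p, (X (some 2) + (j.val : (MvPolynomial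 (Option (Fin 4)) k)) * (X none ^ sh * X (some 0)))) := by
  rw [map_prod, map_prod, map_prod]
  refine Finset.prod_congr rfl fun j _ => ?_
  have hu2 := hΦu 2
  change _ = (algebraMap (MvPolynomial (Option (Fin 4)) k) P) (X (some 2)) at hu2
  rw [map_algebraMap_iterate_sigmaR (hσy := hσy), hu2, qsc_iterate_X2 σ hC h0 h1 h2 t₀ h3 w sh hw2 hh hσh hp hσpL hσJ mo 𝒜 y hy hσy Φ hΦa hΦs hΦu, map_add, map_mul, map_natCast,
    map_mul, map_pow]

set_option maxHeartbeats 1600000 in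
set_option synthInstance.maxHeartbeats 400000 in
include h0 h1 h2 h3 hC hw1 hw2 hΦa hΦs hΦu hσy in
/-- **Image of the intrinsic norm of `ĥ = 2u₂′ − 3s·u₁′²`**: `Φ(N_R(ĥ)/1) = ∏ₗ (2(x′₂ + l c₂) − 3x_none(x′₁ + l c₁)²)`. [OURS · L1 W4.5c · R4c] -/
theorem qsc_map_normR_hHat [NeZero p] :
    Φ ((algebraMap ↥(cobordantAlgebra (fun i => algebraMap (MvPolynomial (Fin 4) k) (Localization.Away hh) (X ((![0, 1, 2] : Fin 3 → Fin 4) i))) w) (ChartRing 𝒜 (fun i => algebraMap (MvPolynomial (Fin 4) k) (Localization.Away hh) (X ((![0, 1, 2] : Fin 3 → Fin 4) i))) w dbar y hy)) (∏ j : ZMod p, (⇑(sigmaR (sigmaAway σ hσh) (fun i => algebraMap (MvPolynomial (Fin 4) k) (Localization.Away hh) (X ((![0, 1, 2] : Fin 3 → Fin 4) i))) w hσJ hp hσpL))^[j.val] (2 * (cobordantAlgebra.u' (fun i => algebraMap (MvPolynomial (Fin 4) k) (Localization.Away hh) (X ((![0, 1, 2] : Fin 3 → Fin 4) i))) w 2)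 - 3 * (cobordantAlgebra.s (fun i => algebraMap (MvPolynomial (Fin 4) k) (Localization.Away hh) (X ((![0, 1, 2] : Fin 3 → Fin 4) i))) w) * (cobordantAlgebra.u' (fun i => algebraMap (MvPolynomial (Fin 4) k) (Localization.Away hh) (X ((![0, 1, 2] : Fin 3 → Fin 4) i))) w 1) ^ 2))) =
      (algebraMap (MvPolynomial (Option (Fin 4)) k) P) (∏ j : ZMod p, (2 * (X (some 2) + (j.val : (MvPolynomial (Option (Fin 4)) k)) * (X none ^ sh * X (some 0))) -
        3 * X none * (X (some 1) + (j.val : (MvPolynomial (Option (Fin 4)) k)) * (X none ^ sh * (X (some 0) * X none ^ (w 0 - (w 1 + sh))))) ^ 2)) := by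
  rw [map_prod, map_prod, map_prod]
  refine Finset.prod_congr rfl fun j _ => ?_
  have hu2 := hΦu 2
  change _ = (algebraMap (MvPolynomial (Option (Fin 4)) k) P) (X (some 2)) at hu2
  have hu1 := hΦu 1
  change _ = (algebraMap (MvPolynomial (Option (Fin 4)) k) P) (X (some 1)) at hu1
  have hX2 := qsc_iterate_X2 σ hC h0 h1 h2 t₀ h3 w sh hw2 hh hσh hp hσpL hσJ mo 𝒜 y hy hσy Φ hΦa hΦs hΦu j.val
  have hX1 := qsc_iterate_X1 σ hC h0 h1 h2 t₀ h3 w sh hw1 hh hσh hp hσpL hσJ mo 𝒜 y hy hσy Φ hΦa hΦs hΦu j.val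
  obtain ⟨rn, -, -⟩ := qsc_rows_fixed σ hC h0 h1 h2 t₀ h3 w hh hσh hp hσpL hσJ mo 𝒜 y hy hσy Φ hΦa hΦs hΦu
  have hXn : (⇑(conj Φ (sigmaChart 𝒜 (fun i => algebraMap (MvPolynomial (Fin 4) k) (Localization.Away hh) (X ((![0, 1, 2] : Fin 3 → Fin 4) i))) w dbar y hy (sigmaAway σ hσh) hσJ hp hσpL hσy)))^[j.val] ((algebraMap (MvPolynomial (Option (Fin 4)) k) P) (X none)) = (algebraMap (MvPolynomial (Option (Fin 4)) k) P) (X none) := Function.iterate_fixed rn j.val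
  obtain ⟨g, hg⟩ := exists_ringHom_eq_iterate (conj Φ (sigmaChart 𝒜 (fun i => algebraMap (MvPolynomial (Fin 4) k) (Localization.Away hh) (X ((![0, 1, 2] : Fin 3 → Fin 4) i))) w dbar y hy (sigmaAway σ hσh) hσJ hp hσpL hσy)) j.val
  rw [← hg] at hX2 hX1 hXn
  have hh' : Φ ((algebraMap ↥(cobordantAlgebra (fun i => algebraMap (MvPolynomial (Fin 4) k) (Localization.Away hh) (X ((![0, 1, 2] : Fin 3 → Fin 4) i))) w) (ChartRing 𝒜 (fun i => algebraMap (MvPolynomial (Fin 4) k) (Localization.Away hh) (X ((![0, 1, 2] : Fin 3 → Fin 4) i))) w dbar y hy)) (2 * (cobordantAlgebra.u' (fun i => algebraMap (MvPolynomial (Fin 4) k) (Localization.Away hh) (X ((![0, 1, 2] : Fin 3 → Fin 4) i))) w 2) - 3 * (cobordantAlgebra.s (fun i => algebraMap (MvPolynomial (Fin 4) k) (Localization.Away hh) (X ((![0, 1, 2] : Fin 3 → Fin 4) i))) w) * (cobordantAlgebra.u' (fun i => algebraMap (MvPolynomial (Fin 4) k) (Localization.Away hh) (X ((![0, 1, 2]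 : Fin 3 → Fin 4) i))) w 1) ^ 2)) = 2 * (algebraMap (MvPolynomial (Option (Fin 4)) k) P) (X (some 2)) - 3 * (algebraMap (MvPolynomial (Option (Fin 4)) k) P) (X none) * (algebraMap (MvPolynomial (Option (Fin 4)) k) P) (X (some 1)) ^ 2 := by
    simp only [map_sub, map_mul, map_pow, map_ofNat, hu2, hu1, hΦs]
  rw [map_algebraMap_iterate_sigmaR (hσy := hσy), ← hg, hh']
  simp only [map_sub, map_add, map_mul, map_pow, map_natCast, map_ofNat, hX2, hX1, hXn]

end Summit.ResolutionOfSingularities.ResolutionOfSingularities.Theorems.WildQuotientResolution.S1.KillCert.QhSym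

end
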